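import Summits.Ventures.PercRepro.RankLevelSetExplicitLin2CoreMult
import Summits.Ventures.PercRepro.RankLevelSetExplicitLin2KeyG
import Summits.Ventures.PercRepro.RankLevelSetExplicitLin2LargeSharp
import Summits.Ventures.PercRepro.RankLevelSetDepCountMultQuart
import Summits.Ventures.PercRepro.S2MultWeightSums

/-!
# PercRepro — THE QUARTIC KEY OF `(P_d)`: THE CORE CELL AND THE LEVEL FROM ONE QUARTIC ROW (p9, S4; p4's lever)

`proofs/SUBCLAIM-S4-p9.md` §S4.2⁗‴. p4's quartic multiplicity (S2QuartMultiplicity, `card_spanF_ge_quart`): every rank-`q` set of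
`m` elements of a matroid with every circuit `≥ 3`, every rank-`2` set `≤ 3` points and every rank-`≤ 3` set `≤ 6` points contains
`≥ quart(m − q) = (m − q) + 3·C(m − q, 2) + 3·C(m − q, 3) + 2·C(m − q, 4)` pairs, so night-1's level count holds with
`quart(m − q)` for `m − q` (`Matroid.ncard_eRk_eq_ncard_eq_mul_le_quart`, RankLevelSetDepCountMultQuart) and the class weights
become `Σ_j C(μ − 1, j)/quart(j + 1) ≤ 192·2^μ/(μ(μ+1)(μ+2)(μ+3))` (`S2.sum_range_choose_div_quart_le`, S2MultWeightSums). The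
quartic key `KeyQ q p d` is the generic key `KeyG` with the certificate `cs = cb = 192`, `Ds = μ_s(μ_s+1)(μ_s+2)(μ_s+3)`,
`Db = μ_b(μ_b+1)(μ_b+2)(μ_b+3)`; `c025_core_lin2_of_keyQ` closes the `e`-free core cell from it (`c025_core_lin2_of_poly_mult`
with the quartic count and weights) and `c025_level_succ_of_keyQ_row` gives the level from one evaluated quartic row
(`c025_level_succ_of_key_row`). The rows (`decide` at the quartic floors
`2,126 / 4,309 / 8,764 / 17,876 / 36,535 / 74,775 / 153,192` at `q = 10 … 16`; at `q = 10 / 11` the floor lies below the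
crude large-corank threshold `N₁(q)`, so the level is assembled through `c025_level_succ_of_keyQ_row'` with the large-corank
theorem from the floor itself as the base of regime one, RankLevelSetExplicitLin2LargeSharp) are the modules
RankLevelSetExplicitLin2QuartRowTen, … . Axioms: standard.
-/

open scoped Matroid

namespace PercRepro

namespace ThmN

namespace Explicit

/-- `μ(μ+1)(μ+2)(μ+3)` — the denominator of the quartic weight certificate. -/
abbrev Pq (μ : ℕ) : ℕ := μ * (μ + 1) * (μ + 2) * (μ + 3)

/-- The quartic multiplicity `quart(v) = v + 3·C(v, 2) + 3·C(v, 3) + 2·C(v, 4)`. -/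
abbrev quartMult (v : ℕ) : ℕ := v + 3 * v.choose 2 + 3 * v.choose 3 + 2 * v.choose 4

/-- **THE QUARTIC KEY**: `KeyG` with the quartic certificate `W·μ(μ+1)(μ+2)(μ+3) ≤ 192·2^μ` in both classes. -/
abbrev KeyQ (q p d : ℕ) : Prop :=
  KeyG q p d 192 (Pq (min (5 * 2 ^ (q - 4) - q) d)) 192 (Pq (min (5 * 2 ^ (q - 3) - q - 1) d))

/-- `KeyQ` is monotone in the rank (`q ≤ d`). -/
theorem keyQ_succ (q p d : ℕ) (hd : q ≤ d) (h : KeyQ q p d) : KeyQ q (p + 1) d :=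
  keyG_succ q p d _ _ _ _ hd h

/-- `KeyQ` at `p₀` gives `KeyQ` at every `p ≥ p₀` (`q ≤ d`). -/
theorem keyQ_mono (q d p₀ p : ℕ) (hd : q ≤ d) (hp : p₀ ≤ p) (h : KeyQ q p₀ d) : KeyQ q p d :=
  keyG_mono q d _ _ _ _ p₀ p hd hp h

/-- **THE QUARTIC WEIGHT BOUND**: `(Σ_{j < N} C(μ − 1, j)/quart(j + 1))·μ(μ+1)(μ+2)(μ+3) ≤ 192·2^μ` for `μ ≥ 1`
(`S2.sum_range_choose_div_quart_le` at `F = μ − 1`). -/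
theorem quart_weight_bound (μ N : ℕ) (hμ : 1 ≤ μ) :
    (∑ j ∈ Finset.range N, (((μ - 1).choose j : ℕ) : ℚ) / ((quartMult (j + 1) : ℕ) : ℚ)) * ((Pq μ : ℕ) : ℚ) ≤
      ((192 : ℕ) : ℚ) * 2 ^ μ := by
  have h := S2.sum_range_choose_div_quart_le (μ - 1) N
  rw [show μ - 1 + 1 = μ by omega, show μ - 1 + 2 = μ + 1 by omega, show μ - 1 + 3 = μ + 2 by omega,
    show μ - 1 + 4 = μ + 3 by omega] at h
  have hpos : (0 : ℚ) < ((Pq μ : ℕ) : ℚ) := by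
    have : 0 < Pq μ := by unfold Pq; positivity
    exact_mod_cast this
  have h' : ∑ j ∈ Finset.range N, (((μ - 1).choose j : ℕ) : ℚ) / ((quartMult (j + 1) : ℕ) : ℚ) ≤
      192 * 2 ^ μ / ((Pq μ : ℕ) : ℚ) := h
  rw [le_div_iff₀ hpos] at h'
  rw [show ((192 : ℕ) : ℚ) = 192 by norm_num]
  exact h'

end Explicit

variable {α : Type}

/-- **THE CORE CELL FROM ITS QUARTIC KEY**: the `e`-free core at level `q ≥ 8`, corank `q + 1 ≤ d ≤ q + 2^q`, rank
`p ≥ 2d + 3q + 5`, satisfies `RLS M p q` once `KeyQ q p d` holds (`c025_core_lin2_of_poly_mult` with the quartic level count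
`ncard_eRk_eq_ncard_eq_mul_le_quart` — its `hC2` is the plane bound of the core — and the quartic weight bound through
`poly_of_keyG`). -/
theorem c025_core_lin2_of_keyQ (q : ℕ) (hq : 8 ≤ q) (M : Matroid α) [M.Finite] (p d : ℕ)
    (hd1 : q + 1 ≤ d) (hd2 : d ≤ q + 2 ^ q) (htail : 2 * d + 3 * q + 5 ≤ p) (hkey : Explicit.KeyQ q p d)
    (hR : M.eRank = (p : ℕ∞)) (hn : M.E.ncard = p + d)
    (hfree : ∀ e ∈ M.E, ∃ A ⊆ M.E \ {e}, e ∉ M.closure A ∧ e ∉ M.closure ((M.E \ {e}) \ A)) :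
    RLS M p q := by
  have hx := Explicit.le_two_pow_sub_four q (by omega)
  obtain ⟨-, -, hq3, h23⟩ := Explicit.two_pow_facts2 q hq
  have hμs1 : 1 ≤ min (5 * 2 ^ (q - 4) - q) d := le_min (by omega) (by omega)
  have hμb1 : 1 ≤ min (5 * 2 ^ (q - 3) - q - 1) d := le_min (by omega) (by omega)
  refine c025_core_lin2_of_poly_mult q hq M p d hd1 hd2 htail Explicit.quartMult
    (fun v hv => by unfold Explicit.quartMult; omega)
    (fun f f' hcirc hC1 hC2 hflat hflat' hd m =>
      Matroid.ncard_eRk_eq_ncard_eq_mul_le_quart M q f f' (by omega) hcirc hC1 hC2 hflat hflat' hd m)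
    (fun A B Ws Wb hWs hWb hA hB => ?_) hR hn hfree
  have hDs : 0 < Explicit.Pq (min (5 * 2 ^ (q - 4) - q) d) := by unfold Explicit.Pq; positivity
  have hDb : 0 < Explicit.Pq (min (5 * 2 ^ (q - 3) - q - 1) d) := by unfold Explicit.Pq; positivity
  refine Explicit.poly_of_keyG q p d 192 _ 192 _ hDs hDb hkey A B Ws Wb ?_ ?_ hA hB
  · rw [hWs]; exact Explicit.quart_weight_bound _ (d - q) hμs1
  · rw [hWb]; exact Explicit.quart_weight_bound _ (d - q) hμb1

/-- **THE LEVEL FROM ONE EVALUATED QUARTIC ROW**: level `q + 1 ≥ 8` for every finite matroid and every `p ≥ p₀` from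
level `q` for every `p ≥ p₀ − 1`, the quartic key row `KeyQ (q + 1) p₀ d` at every core corank `q + 2 ≤ d ≤ q + 1 + 2^{q+1}`,
`p₀ ≥ N₁(q + 1)` and the tail `2(q + 1 + 2^{q+1}) + 3(q + 1) + 5 ≤ p₀` (`c025_level_succ_of_key_row`). -/
theorem c025_level_succ_of_keyQ_row (q : ℕ) (hq : 7 ≤ q) (p₀ : ℕ)
    (hN : 2 ^ (q + 1 + 1) + 2 * (q + 1) ^ 2 + 4 * (q + 1) + 4 ≤ p₀)
    (htail : 2 * (q + 1 + 2 ^ (q + 1)) + 3 * (q + 1) + 5 ≤ p₀)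
    (hrow : ∀ t < 2 ^ (q + 1), Explicit.KeyQ (q + 1) p₀ (q + 2 + t))
    (hprev : ∀ (M : Matroid α) [M.Finite] (p : ℕ), p₀ - 1 ≤ p → RLS M p q) :
    ∀ (M : Matroid α) [M.Finite] (p : ℕ), p₀ ≤ p → RLS M p (q + 1) :=
  c025_level_succ_of_key_row q hq p₀ (Explicit.KeyQ (q + 1)) hN htail
    (fun p d hd h => Explicit.keyQ_succ (q + 1) p d hd h)
    (fun M _ p d hd1 hd2 ht hk hR hn hfree => c025_core_lin2_of_keyQ (q + 1) (by omega) M p d hd1 hd2 ht hk hR hn hfree)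
    hrow hprev

/-- **THE LEVEL FROM ONE EVALUATED QUARTIC ROW, WITH THE LARGE-CORANK THEOREM FROM A BASE**: as `c025_level_succ_of_keyQ_row`,
but the coranks `> q + 1 + 2^{q+1}` are closed by `c025_core_explicit_large_of` from the base `N₁ ≤ p₀` of regime one
(`2(q + 1) ≤ N₁`, the kernel evaluation `hbase` at `N₁`, and regime two from `2^{q+2} + 3(q + 1) + 2 ≤ p₀`). -/
theorem c025_level_succ_of_keyQ_row' (q : ℕ) (hq : 7 ≤ q) (p₀ N₁ : ℕ) (hN₁ : N₁ ≤ p₀) (hm : 2 * (q + 1) ≤ N₁)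
    (hbase : 8 * (q + 1 + 1) * 2 ^ (2 ^ (q + 1) - 1 - (q + 1)) * N₁ ^ (q + 1) ≤ 2 ^ N₁)
    (hp2 : 2 ^ (q + 1 + 1) + 3 * (q + 1) + 2 ≤ p₀)
    (htail : 2 * (q + 1 + 2 ^ (q + 1)) + 3 * (q + 1) + 5 ≤ p₀)
    (hrow : ∀ t < 2 ^ (q + 1), Explicit.KeyQ (q + 1) p₀ (q + 2 + t))
    (hprev : ∀ (M : Matroid α) [M.Finite] (p : ℕ), p₀ - 1 ≤ p → RLS M p q) :
    ∀ (M : Matroid α) [M.Finite] (p : ℕ), p₀ ≤ p → RLS M p (q + 1) :=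
  c025_level_succ_of_key_row' q hq p₀ (Explicit.KeyQ (q + 1))
    (fun M _ p hp hR hbig hfree => c025_core_explicit_large_of (q + 1) (by omega) N₁
      (Explicit.regime_one_of_base (q + 1) N₁ hm hbase) M p (hN₁.trans hp) (hp2.trans hp) hR hbig hfree)
    htail (fun p d hd h => Explicit.keyQ_succ (q + 1) p d hd h)
    (fun M _ p d hd1 hd2 ht hk hR hn hfree => c025_core_lin2_of_keyQ (q + 1) (by omega) M p d hd1 hd2 ht hk hR hn hfree)
    hrow hprev

end ThmN

end PercRepro
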